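import Literature.Topology.FourManifolds.FishtailParamsFacts2
import HarnessLib

/-!
# Facts about the concrete fishtail parameters, III: the latitude and collar-radius profiles

Infrastructure for the explicit fishtail neighbourhood (R. Gompf, *More Cappell–Shaneson spheres
are standard*, Algebr. Geom. Topol. 10 (2010), proof of Thm 2.1 and Lemma 2.2; the named fact
`Literature.Topology.FourManifolds.gompf2010_framedTwist`). For the concrete tube data
`fishTgen ε hε hε2 c ρb μ`: the latitude profile `nfun` (south latitude → affine → `capLat` of the collar
radius `ρ_A (3 - tan α)`) on the windows of the flat annulus and of the north chart — its
values, smoothness and positive derivative — and the collar radius `Pfun = capRad (nfun - 2π)`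
(positive, smooth, nonzero derivative), with the special values on the glue slabs `s₁`, `s₂`.

Everything is proved; no named facts.

## References

* R. E. Gompf, *More Cappell–Shaneson spheres are standard*, Algebr. Geom. Topol. 10 (2010)
  1665–1681, proof of Thm 2.1 and Lemma 2.2. [GompfAGT2010]
-/

noncomputable section

open scoped Real Topology ContDiff
open Set Filter Real

namespace Literature.Topology.FourManifolds

namespace FP

variable {ε : ℝ} (hε : 0 < ε) (hε2 : ε ≤ 1 / 2) {c ρb : ℝ} {μ : ℝ → ℝ}

/-! ### The two branches of the latitude profile -/

/-- The affine/south branch `f = discLat ε n₁ k 1 1 (6/5)`. [folklore] -/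
def latF (ε : ℝ) (r : ℝ) : ℝ := discLat ε (23 * ε / 25) (kLat ε) 1 1 (6 / 5) r

/-- The collar branch `g₂ = capLat ε (ρ_A (3 - tan α)) + 2π`. [folklore] -/
def latG (ε : ℝ) (r : ℝ) : ℝ := capLat ε (flatU ρA (angleUp (rzero ε) r)) + 2 * π

/-- The latitude profile of the concrete data. [folklore] -/
theorem nfun_eq : (fishTgen ε hε hε2 c ρb μ).nfun = blendFun (stdBlend 7 (b2 ε)) (latF ε) (latG ε) := rfl

/-- `(fishTgen ε hε hε2 c ρb μ).Pfun r = capRad ε ((fishTgen ε hε hε2 c ρb μ).nfun r - 2 * π)`. [folklore] -/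
theorem Pfun_eq (r : ℝ) : (fishTgen ε hε hε2 c ρb μ).Pfun r = capRad ε ((fishTgen ε hε hε2 c ρb μ).nfun r - 2 * π) := rfl

/-- `(fishTgen ε hε hε2 c ρb μ).α = angleUp (rzero ε)`. [folklore] -/
theorem alpha_eq : (fishTgen ε hε hε2 c ρb μ).α = angleUp (rzero ε) := rfl

/-! ### The affine branch -/

/-- Above `6/5` the branch is affine: `f r = 23ε/25 + k (r - 1)`. [folklore] -/
theorem latF_of_ge {r : ℝ} (h : 6 / 5 ≤ r) : latF ε r = 23 * ε / 25 + kLat ε * (r - 1) := by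
  rw [latF, discLat_of_ge (by norm_num) h]

/-- Below `1` the branch is the south latitude. [folklore] -/
theorem latF_of_le {r : ℝ} (h : r ≤ 1) : latF ε r = southLat ε r := by
  rw [latF, discLat_of_le (by norm_num) h]

include hε hε2 in
/-- `southLat ε r ≤ 23ε/25 + k (r - 1)` on `[1, 6/5]` (indeed `southLat ≤ ε·r/√(1+r²) ≤ 0.77ε`). [folklore] -/
theorem southLat_le_affine {r : ℝ} (h1 : 1 ≤ r) (h2 : r ≤ 6 / 5) : southLat ε r ≤ 23 * ε / 25 + kLat ε * (r - 1) := by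
  have hk := (kLat_bounds ε hε hε2).1
  rw [southLat_eq]
  have h3 : r / Real.sqrt (1 + r ^ 2) < 23 / 25 := div_sqrt_one_add_sq_lt (by norm_num) (by nlinarith)
  nlinarith

include hε hε2 in
/-- The affine branch has positive derivative. [folklore] -/
theorem deriv_latF_pos (r : ℝ) : 0 < deriv (latF ε) r :=
  deriv_discLat_pos hε (by linarith [(kLat_bounds ε hε hε2).1]) (by norm_num) (fun ρ h1 h2 ↦ southLat_le_affine hε hε2 h1 h2) r

/-- `ContDiff ℝ ∞ (latF ε)`. [folklore] -/
theorem contDiff_latF : ContDiff ℝ ∞ (latF ε) := contDiff_discLat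

include hε hε2 in
/-- `StrictMono (latF ε)`. [folklore] -/
theorem strictMono_latF : StrictMono (latF ε) :=
  strictMono_discLat hε (by linarith [(kLat_bounds ε hε hε2).1]) (by norm_num) fun ρ h1 h2 ↦ southLat_le_affine hε hε2 h1 h2

/-- `f 7 = 2π - 7ε/20`. [folklore] -/
theorem latF_seven : latF ε 7 = 2 * π - 7 * ε / 20 := by
  rw [latF_of_ge (by norm_num), kLat]; ring

/-- **`f r = 2π - 7ε/20 + k (r - 7)` for `r ≥ 6/5`.** [folklore] -/
theorem latF_eq_of_ge {r : ℝ} (h : 6 / 5 ≤ r) : latF ε r = 2 * π - 7 * ε / 20 + kLat ε * (r - 7) := by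
  rw [latF_of_ge h, kLat]; ring

include hε hε2 in
/-- `0 < f r` for `r > 0`. [folklore] -/
theorem latF_pos {r : ℝ} (hr : 0 < r) : 0 < latF ε r := by
  have h0 : latF ε 0 = 0 := by rw [latF_of_le (by norm_num), southLat_eq]; simp
  have := strictMono_latF hε hε2 hr
  rwa [h0] at this

include hε hε2 in
/-- `f r ≥ southLat ε (37/50) > 59ε/100` for `r ≥ 37/50`. [folklore] -/
theorem latF_ge {r : ℝ} (hr : 37 / 50 ≤ r) : 59 * ε / 100 < latF ε r := by
  have h1 : latF ε (37 / 50) ≤ latF ε r := (strictMono_latF hε hε2).monotone hr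
  rw [latF_of_le (by norm_num), southLat_eq] at h1
  have h2 : 59 / 100 < (37 / 50 : ℝ) / Real.sqrt (1 + (37 / 50 : ℝ) ^ 2) := by
    rw [lt_div_iff₀ (Real.sqrt_pos.2 (by norm_num)), ← sub_pos]
    have : Real.sqrt (1 + (37 / 50 : ℝ) ^ 2) < 37 / 50 / (59 / 100) := by
      rw [Real.sqrt_lt' (by norm_num)]; norm_num
    nlinarith
  nlinarith

/-! ### The collar branch -/

/-- `-tan α ≤ (1 + u²)/((3/2) u)` for `α = α(r₀ - x)`, `u = 1/x`, `1/√3 < x`. [folklore] -/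
theorem neg_tan_alpha_le {x : ℝ} (hx : 1 / Real.sqrt 3 < x) :
    -Real.tan (angleUp (rzero ε) (rzero ε - x)) ≤ (1 + x⁻¹ ^ 2) / (3 / 2 * x⁻¹) := by
  obtain ⟨hi1, hi2⟩ := inv_sqrt_three_bounds
  have hx0 : 0 < x := by linarith
  have hu0 : 0 < x⁻¹ := inv_pos.2 hx0
  rw [angleUp_eq_neg_add _ hx0]
  set y := 3 / 2 * Real.arctan x⁻¹ with hy
  have hy0 : 0 < y := by have := Real.arctan_pos.2 hu0; positivity
  have hy2 : y < π / 2 := by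
    -- `arctan (1/x) < arctan √3 = π/3`
    have hs3 : 0 < Real.sqrt 3 := Real.sqrt_pos.2 (by norm_num)
    have hux : x⁻¹ < Real.sqrt 3 := by
      rw [inv_lt_comm₀ hx0 hs3]
      calc (Real.sqrt 3)⁻¹ = 1 / Real.sqrt 3 := (one_div _).symm
        _ < x := hx
    have := Real.arctan_strictMono hux
    rw [Real.arctan_sqrt_three] at this
    linarith
  rw [show -(π / 2) + y = y - π / 2 by ring, tan_sub_pi_div_two, neg_neg]
  have hty : 3 / 2 * (x⁻¹ / (1 + x⁻¹ ^ 2)) ≤ Real.tan y := by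
    have h1 := div_one_add_sq_le_arctan hu0.le
    have h2 : y ≤ Real.tan y := Real.le_tan hy0.le hy2
    nlinarith
  have hpos : 0 < 3 / 2 * (x⁻¹ / (1 + x⁻¹ ^ 2)) := by positivity
  calc (Real.tan y)⁻¹ ≤ (3 / 2 * (x⁻¹ / (1 + x⁻¹ ^ 2)))⁻¹ := inv_anti₀ hpos hty
    _ = (1 + x⁻¹ ^ 2) / (3 / 2 * x⁻¹) := by field_simp

/-- The collar radius is positive where `α < π/2`… precisely `flatU ρ_A α ≥ 3 ρ_A` where `α ≤ 0`. [folklore] -/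
theorem flatU_alpha_ge {r : ℝ} (h : angleUp (rzero ε) r ≤ 0) : 3 * ρA ≤ flatU ρA (angleUp (rzero ε) r) := by
  have h1 := (angleUp_mem (rzero ε) r).1
  have ht : Real.tan (angleUp (rzero ε) r) ≤ 0 :=
    Real.tan_nonpos_of_nonpos_of_neg_pi_div_two_le h h1.le
  unfold flatU ρA; nlinarith

/-- **`g₂ ≥ 2π - 49ε/100` on `0 < r₀ - r ≤ 12`** (`P ≤ ρ_A (3 + 8.06) < 0.553`, `P/√(1+P²) < 0.49`). [folklore] -/
theorem latG_ge (hε : 0 < ε) {r : ℝ} (h1 : rzero ε - 1201 / 100 ≤ r) (h2 : r < rzero ε - 1 / Real.sqrt 3) :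
    2 * π - 49 * ε / 100 < latG ε r := by
  obtain ⟨hi1, hi2⟩ := inv_sqrt_three_bounds
  set x := rzero ε - r with hx
  have hr : r = rzero ε - x := by rw [hx]; ring
  have hx1 : 1 / Real.sqrt 3 < x := by linarith
  have hx2 : x ≤ 1201 / 100 := by linarith
  have hx0 : 0 < x := by linarith
  have hα0 : angleUp (rzero ε) r ≤ 0 := by
    rw [← angleUp_sub_inv_sqrt_three (rzero ε)]; exact (strictMono_angleUp _).monotone h2.le
  set P := flatU ρA (angleUp (rzero ε) r) with hP_def
  have hP0 : 3 / 20 ≤ P := by have := flatU_alpha_ge hα0; unfold ρA at this; rw [hP_def, ρA]; linarith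
  have htan := neg_tan_alpha_le (ε := ε) hx1
  rw [← hr] at htan
  have hb : (1 + x⁻¹ ^ 2) / (3 / 2 * x⁻¹) = (x ^ 2 + 1) / (3 / 2 * x) := by field_simp
  rw [hb] at htan
  have hq : (x ^ 2 + 1) / (3 / 2 * x) ≤ 807 / 100 := by
    rw [div_le_iff₀ (by positivity)]; nlinarith
  have hP1 : P ≤ 5535 / 10000 := by rw [hP_def, flatU, ρA]; linarith
  have hsq : P ^ 2 ≤ (5535 / 10000) ^ 2 := pow_le_pow_left₀ (by linarith) hP1 2
  have hP : P / Real.sqrt (1 + P ^ 2) < 49 / 100 := div_sqrt_one_add_sq_lt (by norm_num) (by nlinarith)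
  rw [latG, capLat, ← hP_def]
  have h3 : ε * P / Real.sqrt (1 + P ^ 2) < 49 * ε / 100 := by
    rw [mul_div_assoc]; nlinarith
  have h4 : -ε * P / Real.sqrt (1 + P ^ 2) = -(ε * P / Real.sqrt (1 + P ^ 2)) := by ring
  rw [h4]; linarith

/-- **`g₂ ≥ 2π - 8ε/25` on `4.99 ≤ r₀ - r ≤ 5.3`** (`-tan α ≤ 3.66`, `P ≤ 0.333`, `P/√(1+P²) < 0.32`). [folklore] -/
theorem latG_ge' (hε : 0 < ε) {r : ℝ} (h1 : rzero ε - 133 / 25 ≤ r) (h2 : r ≤ rzero ε - 497 / 100) :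
    2 * π - 8 * ε / 25 < latG ε r := by
  obtain ⟨hi1, hi2⟩ := inv_sqrt_three_bounds
  set x := rzero ε - r with hx
  have hr : r = rzero ε - x := by rw [hx]; ring
  have hx1 : 497 / 100 ≤ x := by linarith
  have hx2 : x ≤ 133 / 25 := by linarith
  have hx0 : 0 < x := by linarith
  have hα0 : angleUp (rzero ε) r ≤ 0 := by
    rw [← angleUp_sub_inv_sqrt_three (rzero ε)]; exact (strictMono_angleUp _).monotone (by linarith)
  set P := flatU ρA (angleUp (rzero ε) r) with hP_def
  have hP0 : 3 / 20 ≤ P := by have := flatU_alpha_ge hα0; unfold ρA at this; rw [hP_def, ρA]; linarith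
  have htan := neg_tan_alpha_le (ε := ε) (x := x) (by linarith)
  rw [← hr] at htan
  have hb : (1 + x⁻¹ ^ 2) / (3 / 2 * x⁻¹) = (x ^ 2 + 1) / (3 / 2 * x) := by field_simp
  rw [hb] at htan
  have hq : (x ^ 2 + 1) / (3 / 2 * x) ≤ 368 / 100 := by
    rw [div_le_iff₀ (by positivity)]; nlinarith
  have hP1 : P ≤ 334 / 1000 := by rw [hP_def, flatU, ρA]; linarith
  have hsq : P ^ 2 ≤ (334 / 1000) ^ 2 := pow_le_pow_left₀ (by linarith) hP1 2
  have hP : P / Real.sqrt (1 + P ^ 2) < 32 / 100 := div_sqrt_one_add_sq_lt (by norm_num) (by nlinarith)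
  rw [latG, capLat, ← hP_def]
  have h3 : ε * P / Real.sqrt (1 + P ^ 2) < 32 * ε / 100 := by
    rw [mul_div_assoc]; nlinarith
  have h4 : -ε * P / Real.sqrt (1 + P ^ 2) = -(ε * P / Real.sqrt (1 + P ^ 2)) := by ring
  rw [h4]; linarith

/-- `g₂ < 2π` where `α ≤ 0` (the collar radius is positive). [folklore] -/
theorem latG_lt (hε : 0 < ε) {r : ℝ} (h : angleUp (rzero ε) r ≤ 0) : latG ε r < 2 * π := by
  have hP0 : 0 < flatU ρA (angleUp (rzero ε) r) := by
    have := flatU_alpha_ge (ε := ε) h; have hρ := ρA_pos; linarith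
  have := capLat_neg hε hP0
  rw [latG]; linarith

/-- The collar branch is smooth where `cos α ≠ 0`, with derivative
`capLat' (P) · (-ρ_A / cos² α) · α' > 0`. [folklore] -/
theorem hasDerivAt_latG {r : ℝ} (hc : Real.cos (angleUp (rzero ε) r) ≠ 0) :
    HasDerivAt (latG ε) (-ε / ((1 + flatU ρA (angleUp (rzero ε) r) ^ 2) * Real.sqrt (1 + flatU ρA (angleUp (rzero ε) r) ^ 2)) *
      (-(ρA * (1 / Real.cos (angleUp (rzero ε) r) ^ 2)) * (3 / 2 * (1 / (1 + (r - rzero ε) ^ 2))))) r := by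
  have h1 := hasDerivAt_angleUp (rzero ε) r
  have h2 := (hasDerivAt_flatU (ρ := ρA) hc).comp r h1
  have h3 := (hasDerivAt_capLat ε (flatU ρA (angleUp (rzero ε) r))).comp r h2
  exact h3.add_const (2 * π)

/-- `0 < deriv (latG ε) r`. [folklore] -/
theorem deriv_latG_pos (hε : 0 < ε) {r : ℝ} (hc : Real.cos (angleUp (rzero ε) r) ≠ 0) : 0 < deriv (latG ε) r := by
  rw [(hasDerivAt_latG hc).deriv]
  have hρ := ρA_pos
  have h1 : 0 < (1 + flatU ρA (angleUp (rzero ε) r) ^ 2) * Real.sqrt (1 + flatU ρA (angleUp (rzero ε) r) ^ 2) := by positivity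
  have h2 : 0 < Real.cos (angleUp (rzero ε) r) ^ 2 := by positivity
  have h3 : 0 < ρA * (1 / Real.cos (angleUp (rzero ε) r) ^ 2) * (3 / 2 * (1 / (1 + (r - rzero ε) ^ 2))) := by positivity
  have h4 : -ε / ((1 + flatU ρA (angleUp (rzero ε) r) ^ 2) * Real.sqrt (1 + flatU ρA (angleUp (rzero ε) r) ^ 2)) < 0 :=
    div_neg_of_neg_of_pos (by linarith) h1
  nlinarith

/-- `ContDiffAt ℝ ∞ (latG ε) r`. [folklore] -/
theorem contDiffAt_latG {r : ℝ} (hc : Real.cos (angleUp (rzero ε) r) ≠ 0) : ContDiffAt ℝ ∞ (latG ε) r := by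
  unfold latG
  exact (((contDiff_capLat ε).contDiffAt).comp r ((contDiffAt_flatU (ρ := ρA) hc).comp r
    (contDiff_angleUp _).contDiffAt)).add contDiffAt_const

/-- Where `α < 0`… precisely for `r < r₀ - 1/√3`: `cos α ≠ 0` (`α ∈ (-π/2, 0)`). [folklore] -/
theorem cos_alpha_ne_zero {r : ℝ} (h : r < rzero ε - 1 / Real.sqrt 3) : Real.cos (angleUp (rzero ε) r) ≠ 0 := by
  have h1 := (angleUp_mem (rzero ε) r).1
  have h2 : angleUp (rzero ε) r < 0 := by
    rw [← angleUp_sub_inv_sqrt_three (rzero ε)]; exact strictMono_angleUp _ h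
  exact (Real.cos_pos_of_mem_Ioo ⟨h1, by linarith [Real.pi_pos]⟩).ne'

/-! ### The blended profile on `(0, r₀ - 1/√3)` -/

include hε hε2 in
/-- **`f ≤ g₂` on `(0, b₂]`** (needs `ε ≤ 1/2`). [folklore] -/
theorem latF_le_latG {r : ℝ} (h0 : 0 < r) (h1 : r ≤ b2 ε) : latF ε r ≤ latG ε r := by
  obtain ⟨hk1, hk2⟩ := kLat_bounds ε hε hε2
  obtain ⟨hi1, hi2⟩ := inv_sqrt_three_bounds
  have hr0 : rzero ε = 12 + ε / 100 := by unfold rzero b2; ring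
  have hb2 : b2 ε = 7 + ε / 100 := rfl
  rcases le_or_gt r (671 / 100) with hle | hgt
  · -- `f ≤ 2π - 49ε/100 ≤ g₂`
    have hg := latG_ge (ε := ε) hε (r := r) (by rw [hr0]; linarith) (by rw [hr0]; linarith)
    have hf : latF ε r ≤ 2 * π - 49 * ε / 100 := by
      rcases le_or_gt r (6 / 5) with hs | hs
      · -- `f ≤ f(6/5) = 23ε/25 + k/5`
        have := (strictMono_latF hε hε2).monotone hs
        rw [latF_of_ge le_rfl] at this
        nlinarith [Real.pi_gt_three]
      · rw [latF_eq_of_ge hs.le]; nlinarith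
    linarith
  · have hg := latG_ge' (ε := ε) hε (r := r) (by rw [hr0]; linarith) (by rw [hr0]; rw [hb2] at h1; linarith)
    rw [latF_eq_of_ge (by linarith)]
    rw [hb2] at h1
    nlinarith

include hε hε2 in
/-- **The latitude profile has positive derivative on `(0, r₀ - 1/√3)`.** [folklore] -/
theorem deriv_nfun_pos {r : ℝ} (h0 : 0 < r) (h1 : r < rzero ε - 1 / Real.sqrt 3) : 0 < deriv (fishTgen ε hε hε2 c ρb μ).nfun r := by
  obtain ⟨hi1, hi2⟩ := inv_sqrt_three_bounds
  have hr0 : rzero ε = 12 + ε / 100 := by unfold rzero b2; ring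
  have hc := cos_alpha_ne_zero (ε := ε) h1
  rw [nfun_eq]
  rcases le_or_gt r (b2 ε) with hle | hgt
  · have hχ := hasDerivAt_stdBlend 7 (b2 ε) r
    have hf : HasDerivAt (latF ε) (deriv (latF ε) r) r := ((contDiff_latF (ε := ε)).differentiable (by simp) r).hasDerivAt
    have hg := hasDerivAt_latG (ε := ε) hc
    refine deriv_blendFun_pos hχ hf hg (stdBlend_mem _ _ _).1 (stdBlend_mem _ _ _).2 ?_ (deriv_latF_pos hε hε2 r)
      (by rw [← hg.deriv]; exact deriv_latG_pos hε hc) (latF_le_latG hε hε2 h0 hle)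
    exact mul_nonneg Real.smoothTransition.monotone.deriv_nonneg (by rw [one_div]; exact (inv_pos.2 (by unfold b2; linarith)).le)
  · -- beyond `b₂` the profile is `g₂`
    have hb : b2 ε < r := hgt
    have hev : blendFun (stdBlend 7 (b2 ε)) (latF ε) (latG ε) =ᶠ[𝓝 r] latG ε := by
      filter_upwards [(isOpen_lt continuous_const continuous_id).mem_nhds hb] with r' hr'
      exact blendFun_of_one (stdBlend_of_ge (by unfold b2; linarith) (le_of_lt hr'))
    rw [hev.deriv_eq]; exact deriv_latG_pos hε hc

include hε hε2 in
/-- The latitude profile is smooth on `(-, r₀ - 1/√3)`. [folklore] -/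
theorem contDiffAt_nfun {r : ℝ} (h1 : r < rzero ε - 1 / Real.sqrt 3) : ContDiffAt ℝ ∞ (fishTgen ε hε hε2 c ρb μ).nfun r := by
  rw [nfun_eq]
  exact contDiffAt_blendFun (contDiff_stdBlend _ _).contDiffAt contDiff_latF.contDiffAt (contDiffAt_latG (cos_alpha_ne_zero h1))

include hε hε2 in
/-- Below `7` the profile is the affine/south branch. [folklore] -/
theorem nfun_of_le {r : ℝ} (h : r ≤ 7) : (fishTgen ε hε hε2 c ρb μ).nfun r = latF ε r := by
  rw [nfun_eq, blendFun_of_zero (stdBlend_of_le (by unfold b2; linarith) h)]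

include hε hε2 in
/-- **The profile lies in `(0, 2π)` on `(0, r₀ - 1/√3)`** and is a convex combination of the
branches. [folklore] -/
theorem nfun_lt_two_pi {r : ℝ} (h0 : 0 < r) (h1 : r < rzero ε - 1 / Real.sqrt 3) : (fishTgen ε hε hε2 c ρb μ).nfun r < 2 * π := by
  obtain ⟨hi1, hi2⟩ := inv_sqrt_three_bounds
  have hr0 : rzero ε = 12 + ε / 100 := by unfold rzero b2; ring
  have hα0 : angleUp (rzero ε) r ≤ 0 := by
    rw [← angleUp_sub_inv_sqrt_three (rzero ε)]; exact (strictMono_angleUp _).monotone h1.le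
  have hg := latG_lt hε hα0
  have hb2 : b2 ε = 7 + ε / 100 := rfl
  rcases le_or_gt r (b2 ε) with hle | hgt
  · have hf : latF ε r < 2 * π := by
      calc latF ε r ≤ latG ε r := latF_le_latG hε hε2 h0 hle
        _ < 2 * π := hg
    rw [nfun_eq, blendFun]
    have hχ := stdBlend_mem 7 (b2 ε) r
    rcases le_total (stdBlend 7 (b2 ε) r) (1 / 2) with hle | hge
    · nlinarith [mul_pos (show (0:ℝ) < 1 - stdBlend 7 (b2 ε) r by linarith) (sub_pos.2 hf),
        mul_nonneg hχ.1 (sub_pos.2 hg).le]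
    · nlinarith [mul_nonneg (sub_nonneg.2 hχ.2) (sub_pos.2 hf).le,
        mul_pos (show (0:ℝ) < stdBlend 7 (b2 ε) r by linarith) (sub_pos.2 hg)]
  · rw [nfun_eq, blendFun_of_one (stdBlend_of_ge (by rw [hb2]; linarith) hgt.le)]
    exact hg

include hε hε2 in
/-- `0 < (fishTgen ε hε hε2 c ρb μ).nfun r`. [folklore] -/
theorem nfun_pos {r : ℝ} (h0 : 0 < r) (h1 : r < rzero ε - 1 / Real.sqrt 3) : 0 < (fishTgen ε hε hε2 c ρb μ).nfun r := by
  obtain ⟨hi1, hi2⟩ := inv_sqrt_three_bounds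
  have hr0 : rzero ε = 12 + ε / 100 := by unfold rzero b2; ring
  have hf := latF_pos hε hε2 h0
  have hg : 0 < latG ε r := by
    have := latG_ge (ε := ε) hε (r := r) (by linarith) h1
    nlinarith [Real.pi_gt_three]
  rw [nfun_eq, blendFun]
  have hχ := stdBlend_mem 7 (b2 ε) r
  rcases le_total (stdBlend 7 (b2 ε) r) (1 / 2) with hle | hge
  · nlinarith [mul_pos (show (0:ℝ) < 1 - stdBlend 7 (b2 ε) r by linarith) hf, mul_nonneg hχ.1 hg.le]
  · nlinarith [mul_nonneg (sub_nonneg.2 hχ.2) hf.le, mul_pos (show (0:ℝ) < stdBlend 7 (b2 ε) r by linarith) hg]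

include hε hε2 in
/-- **The latitude profile is strictly increasing on `(0, r₀ - 1/√3)`.** [folklore] -/
theorem strictMonoOn_nfun : StrictMonoOn (fishTgen ε hε hε2 c ρb μ).nfun (Ioo 0 (rzero ε - 1 / Real.sqrt 3)) := by
  refine strictMonoOn_of_deriv_pos (convex_Ioo _ _) (fun r hr ↦ (contDiffAt_nfun hε hε2 hr.2).continuousAt.continuousWithinAt)
    fun r hr ↦ ?_
  rw [interior_Ioo] at hr
  exact deriv_nfun_pos hε hε2 hr.1 hr.2

/-! ### The junction value `L₂ = nfun s₂` -/

/-- `c_R = R₂ / √(1 + R₂²)` (so `capLat ε R₂ = -ε c_R`). [folklore] -/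
def cR : ℝ := Rtwo / Real.sqrt (1 + Rtwo ^ 2)

/-- `cR < 1`. [folklore] -/
theorem cR_lt_one : cR < 1 := by
  rw [cR, div_lt_one (Real.sqrt_pos.2 (by positivity)), Real.lt_sqrt (by linarith [Rtwo_ge])]
  nlinarith

/-- `0 < cR`. [folklore] -/
theorem cR_pos : 0 < cR := by unfold cR; have := Rtwo_ge; positivity

/-- **`1 - c_R ≥ 1 / (2 R₂² + 2)`.** [folklore] -/
theorem one_sub_cR_ge : 1 / (2 * Rtwo ^ 2 + 2) ≤ 1 - cR := by
  have hR := Rtwo_ge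
  have hs : 0 < Real.sqrt (1 + Rtwo ^ 2) := Real.sqrt_pos.2 (by positivity)
  have hsq : Real.sqrt (1 + Rtwo ^ 2) ^ 2 = 1 + Rtwo ^ 2 := Real.sq_sqrt (by positivity)
  rw [cR, le_sub_comm, div_le_iff₀ hs]
  -- `R ≤ (1 - 1/(2R²+2)) √(1+R²) = (2R²+1)/(2R²+2) √(1+R²)`
  have h1 : (1 - 1 / (2 * Rtwo ^ 2 + 2)) = (2 * Rtwo ^ 2 + 1) / (2 * Rtwo ^ 2 + 2) := by
    rw [one_sub_div (by positivity)]; congr 1; ring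
  rw [h1, div_mul_eq_mul_div, le_div_iff₀ (by positivity)]
  -- square: `R² (2R²+2)² ≤ (2R²+1)² (1+R²)`
  have h2 : (Rtwo * (2 * Rtwo ^ 2 + 2)) ^ 2 ≤ ((2 * Rtwo ^ 2 + 1) * Real.sqrt (1 + Rtwo ^ 2)) ^ 2 := by
    rw [mul_pow, mul_pow, hsq]; nlinarith
  exact (pow_le_pow_iff_left₀ (by positivity) (by positivity) two_ne_zero).1 h2

/-- The junction latitude `L₂ = 2π - ε (1 + c_R)/2` (the midpoint of `2π - ε` and `2π + capLat ε R₂`). [folklore] -/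
def L2 (ε : ℝ) : ℝ := 2 * π - ε * (1 + cR) / 2

/-- `s2 ε = 1 + (L2 ε - 23 * ε / 25) / kLat ε`. [folklore] -/
theorem s2_eq : s2 ε = 1 + (L2 ε - 23 * ε / 25) / kLat ε := by
  rw [s2, L2, cR]

include hε hε2 in
/-- `6 < s₂` and `s₂ + η < 7` (indeed `s₂ ≤ 7 - 3ε/5`). [folklore] -/
theorem s2_bounds : 6 < s2 ε ∧ s2 ε + eta ε < 7 := by
  obtain ⟨hk1, hk2⟩ := kLat_bounds ε hε hε2
  have hc1 := cR_lt_one; have hc0 := cR_pos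
  have hk0 : 0 < kLat ε := by linarith
  have hη := eta_le ε hε; have hη0 := eta_pos ε hε
  -- `k (s₂ - 1) = L₂ - 0.92ε = 6k + 0.35ε - ε(1+c_R)/2`
  have hkey : kLat ε * (s2 ε - 1) = 6 * kLat ε + 7 * ε / 20 - ε * (1 + cR) / 2 := by
    rw [s2_eq, L2]; field_simp; rw [kLat]; ring
  constructor
  · by_contra h; rw [not_lt] at h
    have : kLat ε * (s2 ε - 1) ≤ kLat ε * 5 := mul_le_mul_of_nonneg_left (by linarith) hk0.le
    nlinarith
  · by_contra h; rw [not_lt] at h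
    have h1 : kLat ε * (6 - eta ε) ≤ kLat ε * (s2 ε - 1) := mul_le_mul_of_nonneg_left (by linarith) hk0.le
    have h2 : kLat ε * eta ε ≤ 21 / 20 * (ε / 4840) := by nlinarith
    nlinarith

include hε hε2 in
/-- **`nfun s₂ = L₂`**, and on `[6/5, 7]`: `nfun r = L₂ + k (r - s₂)`. [folklore] -/
theorem nfun_eq_L2 {r : ℝ} (h1 : 6 / 5 ≤ r) (h2 : r ≤ 7) : (fishTgen ε hε hε2 c ρb μ).nfun r = L2 ε + kLat ε * (r - s2 ε) := by
  have hk0 : 0 < kLat ε := by linarith [(kLat_bounds ε hε hε2).1]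
  rw [nfun_of_le hε hε2 h2, latF_of_ge h1, s2_eq]
  field_simp
  ring

include hε hε2 in
/-- `k η < ε (1 - c_R)/2` (the slab at `s₂` stays inside `(2π - ε, 2π + capLat ε R₂)`). [folklore] -/
theorem kLat_mul_eta_lt : kLat ε * eta ε < ε * (1 - cR) / 2 := by
  obtain ⟨hk1, hk2⟩ := kLat_bounds ε hε hε2
  have hR := Rtwo_ge
  have h1 := one_sub_cR_ge
  have h2 : kLat ε * eta ε < 21 / 20 * (ε / (10 * Rtwo ^ 2)) := by
    unfold eta; exact mul_lt_mul_of_pos_right hk2 (by positivity)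
  have h3 : 21 / 20 * (ε / (10 * Rtwo ^ 2)) ≤ ε * (1 / (2 * Rtwo ^ 2 + 2)) / 2 := by
    rw [show 21 / 20 * (ε / (10 * Rtwo ^ 2)) = ε * (21 / (200 * Rtwo ^ 2)) by field_simp; ring,
      show ε * (1 / (2 * Rtwo ^ 2 + 2)) / 2 = ε * (1 / (4 * Rtwo ^ 2 + 4)) by field_simp; ring]
    refine mul_le_mul_of_nonneg_left ?_ hε.le
    rw [div_le_div_iff₀ (by positivity) (by positivity)]
    nlinarith
  have h4 : ε * (1 / (2 * Rtwo ^ 2 + 2)) / 2 ≤ ε * (1 - cR) / 2 := by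
    have := mul_le_mul_of_nonneg_left h1 hε.le; linarith
  linarith

include hε hε2 in
/-- **On the slab at `s₂`**: `-ε < nfun - 2π ≤ capLat ε R₂` (so `R₂ ≤ Pfun`), and `nB ≤ nfun`. [folklore] -/
theorem nfun_slab2 {r : ℝ} (h : |r - s2 ε| < eta ε) :
    -ε < (fishTgen ε hε hε2 c ρb μ).nfun r - 2 * π ∧ (fishTgen ε hε hε2 c ρb μ).nfun r - 2 * π ≤ capLat ε Rtwo ∧ nB ε ≤ (fishTgen ε hε hε2 c ρb μ).nfun r := by
  obtain ⟨hs1, hs2⟩ := s2_bounds hε hε2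
  obtain ⟨hk1, hk2⟩ := kLat_bounds ε hε hε2
  have hη := eta_lt hε hε2; have hη0 := eta_pos ε hε
  obtain ⟨h1, h2⟩ := abs_lt.1 h
  have hkey := kLat_mul_eta_lt hε hε2
  have hc1 := cR_lt_one; have hc0 := cR_pos
  rw [nfun_eq_L2 hε hε2 (by linarith) (by linarith)]
  have hcap : capLat ε Rtwo = -ε * cR := by rw [capLat, cR]; ring
  have hkr : |kLat ε * (r - s2 ε)| < kLat ε * eta ε := by
    rw [abs_mul, abs_of_pos (by linarith)]; exact mul_lt_mul_of_pos_left h (by linarith)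
  obtain ⟨hkr1, hkr2⟩ := abs_lt.1 hkr
  refine ⟨?_, ?_, ?_⟩
  · rw [L2]; nlinarith
  · rw [hcap, L2]; nlinarith
  · rw [L2, nB]; nlinarith [Real.pi_gt_three]

include hε hε2 in
/-- On the slab at `s₂`: `R₂ ≤ Pfun` and `(nfun - 2π)² < ε²`. [folklore] -/
theorem Pfun_slab2 {r : ℝ} (h : |r - s2 ε| < eta ε) :
    Rtwo ≤ (fishTgen ε hε hε2 c ρb μ).Pfun r ∧ ((fishTgen ε hε hε2 c ρb μ).nfun r - 2 * π) ^ 2 < ε ^ 2 := by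
  obtain ⟨h1, h2, -⟩ := nfun_slab2 hε hε2 h
  have hneg : capLat ε Rtwo < 0 := capLat_neg hε (by linarith [Rtwo_ge])
  refine ⟨?_, by nlinarith⟩
  rw [Pfun_eq, ← capRad_capLat hε Rtwo]
  exact capRad_le_capRad h1 h2 hneg.le

/-! ### The flat-annulus window `(s₁ - η, s₂ + η)` and the slab at `s₁` -/

include hε hε2 in
/-- On the slab at `s₁ = 3/4`: `nfun = southLat < nA`, and `stdBlend 7 b₂ r = 0`. [folklore] -/
theorem nfun_slab1 {r : ℝ} (h : |r - 3 / 4| < eta ε) :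
    (fishTgen ε hε hε2 c ρb μ).nfun r = southLat ε r ∧ southLat ε r < nA ε ∧ stdBlend 7 (b2 ε) r = 0 := by
  have hη := eta_lt hε hε2
  obtain ⟨h1, h2⟩ := abs_lt.1 h
  refine ⟨by rw [nfun_of_le hε hε2 (by linarith), latF_of_le (by linarith)], ?_, stdBlend_of_le (by unfold b2; linarith) (by linarith)⟩
  rw [southLat_eq, nA]
  have := div_sqrt_one_add_sq_lt (r := r) (c := 61 / 100) (by norm_num) (by nlinarith)
  nlinarith

/-- `c_R ≥ 9989/10000` (`R₂ ≥ 22`). [folklore] -/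
theorem cR_ge : 9989 / 10000 ≤ cR := by
  have hR := Rtwo_ge
  rw [cR, le_div_iff₀ (Real.sqrt_pos.2 (by positivity))]
  have h1 : Real.sqrt (1 + Rtwo ^ 2) ≤ Rtwo + 1 / (2 * Rtwo) := by
    rw [Real.sqrt_le_left (by positivity)]
    have : (Rtwo + 1 / (2 * Rtwo)) ^ 2 = Rtwo ^ 2 + 1 + 1 / (4 * Rtwo ^ 2) := by field_simp; ring
    rw [this]; have : 0 < 1 / (4 * Rtwo ^ 2) := by positivity
    linarith
  have h3 : 9989 / 10000 * (Rtwo + 1 / (2 * Rtwo)) ≤ Rtwo := by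
    have : 1 / (2 * Rtwo) ≤ 1 / 44 := by rw [div_le_div_iff₀ (by positivity) (by norm_num)]; linarith
    nlinarith
  nlinarith

include hε hε2 in
/-- **On the flat-annulus window** (`37/50 ≤ r < s₂ + η`): `59ε/100 < nfun < 2π - 99ε/100`
(below the slit of the model seam); in particular `0 < nfun < 2π` and `λ < nfun`. [folklore] -/
theorem nfun_winA {r : ℝ} (h1 : 37 / 50 ≤ r) (h2 : r < s2 ε + eta ε) :
    59 * ε / 100 < (fishTgen ε hε hε2 c ρb μ).nfun r ∧ (fishTgen ε hε hε2 c ρb μ).nfun r < 2 * π - 99 * ε / 100 := by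
  obtain ⟨hs1, hs2⟩ := s2_bounds hε hε2
  obtain ⟨hk1, hk2⟩ := kLat_bounds ε hε hε2
  have hη := eta_lt hε hε2
  have hη0 := eta_pos ε hε
  have hc1 := cR_lt_one
  have hcR := cR_ge
  constructor
  · rw [nfun_of_le hε hε2 (by linarith)]; exact latF_ge hε hε2 h1
  · have hmono : (fishTgen ε hε hε2 c ρb μ).nfun r ≤ L2 ε + kLat ε * eta ε := by
      rcases le_or_gt r (6 / 5) with hr | hr
      · rw [nfun_of_le hε hε2 (by linarith)]
        have := (strictMono_latF hε hε2).monotone hr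
        rw [latF_of_ge le_rfl] at this
        rw [L2]
        nlinarith [Real.pi_gt_three, mul_pos (by linarith : (0:ℝ) < kLat ε) hη0]
      · rw [nfun_eq_L2 hε hε2 hr.le (by linarith)]; nlinarith
    have hkη : kLat ε * eta ε < ε / 4000 := by
      have := eta_le ε hε
      calc kLat ε * eta ε < 21 / 20 * eta ε := mul_lt_mul_of_pos_right hk2 hη0
        _ ≤ 21 / 20 * (ε / 4840) := by nlinarith
        _ < ε / 4000 := by nlinarith
    rw [L2] at hmono
    nlinarith


/-! ### The north-chart window `(s₂ - η, r₀ - 1/√3)` -/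

include hε hε2 in
/-- **On the north-chart window**: `2π - ε < nfun < 2π`. [folklore] -/
theorem nfun_winN {r : ℝ} (h1 : s2 ε - eta ε < r) (h2 : r < rzero ε - 1 / Real.sqrt 3) :
    2 * π - ε < (fishTgen ε hε hε2 c ρb μ).nfun r ∧ (fishTgen ε hε hε2 c ρb μ).nfun r < 2 * π := by
  obtain ⟨hs1, hs2⟩ := s2_bounds hε hε2
  obtain ⟨hi1, hi2⟩ := inv_sqrt_three_bounds
  have hη := eta_lt hε hε2; have hη0 := eta_pos ε hε
  have hr0 : rzero ε = 12 + ε / 100 := by unfold rzero b2; ring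
  have hr : 0 < r := by linarith
  refine ⟨?_, nfun_lt_two_pi hε hε2 hr h2⟩
  have hkey := kLat_mul_eta_lt hε hε2
  have hc0 := cR_pos
  have hval : (fishTgen ε hε hε2 c ρb μ).nfun (s2 ε - eta ε) = L2 ε - kLat ε * eta ε := by
    rw [nfun_eq_L2 hε hε2 (by linarith) (by linarith)]; ring
  have hlow : 2 * π - ε < (fishTgen ε hε hε2 c ρb μ).nfun (s2 ε - eta ε) := by rw [hval, L2]; nlinarith
  have hmono := (strictMonoOn_nfun hε hε2 (c := c) (ρb := ρb) (μ := μ)) ⟨by linarith, by linarith⟩ ⟨hr, h2⟩ h1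
  linarith

include hε hε2 in
/-- On the north-chart window `(nfun - 2π)² < ε²` and `nfun - 2π < 0`. [folklore] -/
theorem nfun_winN' {r : ℝ} (h1 : s2 ε - eta ε < r) (h2 : r < rzero ε - 1 / Real.sqrt 3) :
    ((fishTgen ε hε hε2 c ρb μ).nfun r - 2 * π) ^ 2 < ε ^ 2 ∧ (fishTgen ε hε hε2 c ρb μ).nfun r - 2 * π < 0 := by
  obtain ⟨h3, h4⟩ := nfun_winN hε hε2 h1 h2
  exact ⟨by nlinarith, by linarith⟩

include hε hε2 in
/-- **The collar radius is positive on the north-chart window.** [folklore] -/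
theorem Pfun_pos {r : ℝ} (h1 : s2 ε - eta ε < r) (h2 : r < rzero ε - 1 / Real.sqrt 3) : 0 < (fishTgen ε hε hε2 c ρb μ).Pfun r := by
  obtain ⟨h3, h4⟩ := nfun_winN' hε hε2 h1 h2
  rw [Pfun_eq]; exact capRad_pos h3 h4

include hε hε2 in
/-- The collar radius is smooth on the north-chart window. [folklore] -/
theorem contDiffAt_Pfun {r : ℝ} (h1 : s2 ε - eta ε < r) (h2 : r < rzero ε - 1 / Real.sqrt 3) :
    ContDiffAt ℝ ∞ (fishTgen ε hε hε2 c ρb μ).Pfun r := by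
  obtain ⟨h3, -⟩ := nfun_winN' hε hε2 h1 h2
  have h : (fishTgen ε hε hε2 c ρb μ).Pfun = fun r ↦ capRad ε ((fishTgen ε hε hε2 c ρb μ).nfun r - 2 * π) := rfl
  rw [h]
  exact (contDiffAt_capRad h3).comp r ((contDiffAt_nfun hε hε2 h2).sub contDiffAt_const)

include hε hε2 in
/-- **The collar radius has nonvanishing derivative on the north-chart window** (`capLat ∘ Pfun = nfun - 2π`
there, and `nfun' > 0`). [folklore] -/
theorem deriv_Pfun_ne_zero {r : ℝ} (h1 : s2 ε - eta ε < r) (h2 : r < rzero ε - 1 / Real.sqrt 3) :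
    deriv (fishTgen ε hε hε2 c ρb μ).Pfun r ≠ 0 := by
  set T := fishTgen ε hε hε2 c ρb μ
  have hopen : IsOpen {r' : ℝ | s2 ε - eta ε < r' ∧ r' < rzero ε - 1 / Real.sqrt 3} :=
    (isOpen_lt continuous_const continuous_id).inter (isOpen_lt continuous_id continuous_const)
  have hev : (fun r' ↦ capLat ε (T.Pfun r')) =ᶠ[𝓝 r] fun r' ↦ T.nfun r' - 2 * π := by
    filter_upwards [hopen.mem_nhds ⟨h1, h2⟩] with r' hr'
    rw [Pfun_eq, capLat_capRad hε (nfun_winN' hε hε2 hr'.1 hr'.2).1]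
  have hd1 : deriv (fun r' ↦ capLat ε (T.Pfun r')) r = deriv T.nfun r := by
    rw [hev.deriv_eq]; simp
  have hdiff : DifferentiableAt ℝ T.Pfun r := (contDiffAt_Pfun hε hε2 h1 h2).differentiableAt (by simp)
  have hchain : deriv (fun r' ↦ capLat ε (T.Pfun r')) r = deriv (capLat ε) (T.Pfun r) * deriv T.Pfun r :=
    deriv_comp r ((contDiff_capLat ε).differentiable (by simp) _) hdiff
  intro h0
  have := deriv_nfun_pos hε hε2 (c := c) (ρb := ρb) (μ := μ) (by linarith [(s2_bounds hε hε2).1, eta_lt hε hε2]) h2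
  rw [← hd1, hchain, h0, mul_zero] at this
  exact lt_irrefl _ this

/-! ### The slab at `s₃` (the junction with the collar annulus) -/

include hε hε2 in
/-- **On `|r - s₃| < 1/10`**: `nfun = g₂`, `Pfun = ρ_A (3 - tan α) ∈ [3ρ_A, 4ρ_A)`, `-π/4 < α < 0`. [folklore] -/
theorem Pfun_slab3 {r : ℝ} (h : |r - s3 ε| < 1 / 10) :
    (fishTgen ε hε hε2 c ρb μ).Pfun r = flatU ρA (angleUp (rzero ε) r) ∧ 3 * ρA ≤ flatU ρA (angleUp (rzero ε) r) ∧
      flatU ρA (angleUp (rzero ε) r) < 4 * ρA ∧ stdBlend 7 (b2 ε) r = 1 := by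
  obtain ⟨hα1, hα2⟩ := alpha_slab3 h
  obtain ⟨h1, h2⟩ := abs_lt.1 h
  obtain ⟨hi1, hi2⟩ := inv_sqrt_three_bounds
  have hr0 : rzero ε = 12 + ε / 100 := by unfold rzero b2; ring
  unfold s3 at h1 h2
  have hb : stdBlend 7 (b2 ε) r = 1 := stdBlend_of_ge (by unfold b2; linarith) (by unfold b2; linarith)
  have hn : (fishTgen ε hε hε2 c ρb μ).nfun r = latG ε r := by rw [nfun_eq, blendFun_of_one hb]
  have hP0 := flatU_alpha_ge hα2.le
  have htan : -1 < Real.tan (angleUp (rzero ε) r) := by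
    have := Real.tan_lt_tan_of_lt_of_lt_pi_div_two (by linarith [Real.pi_pos]) (by linarith [Real.pi_pos]) hα1
    rwa [Real.tan_neg, Real.tan_pi_div_four] at this
  refine ⟨?_, hP0, by unfold flatU; have := ρA_pos; nlinarith, hb⟩
  rw [Pfun_eq, hn, latG, add_sub_cancel_right, capRad_capLat hε]

end FP

end Literature.Topology.FourManifolds
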